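import Literature.MathematicalPhysics.QuantumFieldTheory.Balaban1983to89.B1Eq324BenfattoSect5FreeStepCross
import Literature.MathematicalPhysics.QuantumFieldTheory.Balaban1983to89.B1Eq324BenfattoSect5FreeStepCrossMasses
import Literature.MathematicalPhysics.QuantumFieldTheory.Balaban1983to89.B1Eq324BenfattoSect5LegGeometry
import HarnessLib

/-!
# `Balaban1983to89.B1Eq324BenfattoSect5FreeStepCrossBound` — [BenfattoEtAl1978] §5 p. 159: the CROSS colourings of one pavement
# step in CLOSED FORM — `|CROSS_{k+1}| ≤ C_{k+1}·|B|·(k+1)k·M_u²·M_u^{k−1}·e^{−(δ/(4(k+1)))(w+v+1)}`-type, EXTENSIVE and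
# exponentially small in the corridor widths — from `…FreeStepCross` + `…FreeStepCrossMasses` + the corridor geometry, PROVED
# for any palette of tuple classes with print's containment / disjointness properties (item (R1-final))

statement-level skeleton of published theorems with citation tags; proofs where landed; nothing here is a claim about the
Yang–Mills mass gap

WHY THIS MODULE (cell `pub-ymgap`, seat `dag-n08-b`, node N08; item (R1-final) of the `BasicLemmaPrinted` assembly map).
`…FreeStepCross.abs_cross_le_sum_anchor` displays, per anchor box `m`, the decay-weighted masses `W_m(c)` of the palette classes from
the deep region `R_A = shrink L m (2w+v) = □′_m∖Γ₄(□_m)`; `…FreeStepCrossMasses` evaluates any such mass (`decayWeightedMass_le`) and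
gives the gain `e^{−(c₂/2)r₀}` for classes anchored at `ρ_m ≥ r₀` (`decayWeightedMass_le_of_far`).  Here the length is fixed to the
`ℓ¹`-distance to `R_A` and print's geometry supplies `r₀ = w+v+1` for every FAR class of anchor `m`: the rest class lives in the
corridors `Γ₁`, which miss `shrink L m w` (`…Boxes.disjoint_corridors_shrink`, `…LegGeometry.le_l1_of_mem_shrink_of_not_mem_shrink`),
and the classes of another box `m' ≠ m` live in `□_{m'}`, disjoint from `□_m` (`…Boxes.disjoint_box`,
`…LegGeometry.le_l1_of_mem_shrink_of_not_mem_box`).  The palette is kept ABSTRACT through four properties (deep tuples meet `R_A`;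
rest tuples inside `Γ₁`; box classes inside their box; classes pairwise disjoint) which print's classes
(`none ↦ tuplesIn Γ₁`, `(m,false) ↦ Ψ′₁(m) ∪ Ψ₂(m)`-classes, `(m,true) ↦ Ψ″₁(m)`-class of `…Sect5PerBoxOnData`) satisfy — that
verification is the assembler's set bookkeeping.

WHAT IS PROVED (theorems only; no definition, no named fact, no `sorry`; axioms standard).
* ★★ **`abs_cross_le_closed`** — `|CROSS_{k+1}| ≤ 2^{(k+1)D}2^{2^{(k+1)D}}K₀^{(k+1)D}·|B|·((k+1)k·(M_u·(M_u^far·M_u^{k−1})))` with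
  `M_u = A e^{(δ/2)D²d}·(L^d·K(c₂,d))·S(c)`, `M_u^far = A e^{(δ/2)D²d}·e^{−(c₂/2)(w+v+1)}·(L^d·K(c₂/2,d))·S(c)`, `c₂ = δ/(2(k+1))`,
  `c = ϰ/2 − (δ/2)D²√d`.

HONEST SCOPE / NOT HERE.  The four palette properties for print's classes, the `W₂₉` within-box twin, and the assembly are NOT here.
`BasicLemmaPrinted` stays OPEN.  NOT summit progress; count-neutral for N08; nothing of [Balaban1985UV3] (41)/(47)/(5) is asserted.
-/

open MeasureTheory ProbabilityTheory Finset
open scoped BigOperators Nat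

namespace Literature.MathematicalPhysics.QuantumFieldTheory.Balaban1983to89.B1Eq324BenfattoSect5FreeStepCrossBound

open _root_.MeasureTheory _root_.ProbabilityTheory
open Literature.Probability.LatticeModels (ursellOf)
open Literature.MathematicalPhysics.QuantumFieldTheory
open Literature.MathematicalPhysics.QuantumFieldTheory.Balaban1983to89.B1Eq324BenfattoLemma
open Literature.MathematicalPhysics.QuantumFieldTheory.Balaban1983to89.B1Eq324BenfattoSect5Boxes
open Literature.MathematicalPhysics.QuantumFieldTheory.Balaban1983to89.B1Eq324BenfattoSect5Eq511 (term)
open Literature.MathematicalPhysics.QuantumFieldTheory.Balaban1983to89.B1Eq324BenfattoSect5Eq524 (card_shrink_le)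
open Literature.MathematicalPhysics.QuantumFieldTheory.Balaban1983to89.B1Eq324BenfattoSect5LegGeometry
  (le_l1_of_mem_shrink_of_not_mem_shrink le_l1_of_mem_shrink_of_not_mem_box)
open Literature.MathematicalPhysics.QuantumFieldTheory.Balaban1983to89.B1Eq324BenfattoSect5FreeStepCross (abs_cross_le_sum_anchor)
open Literature.MathematicalPhysics.QuantumFieldTheory.Balaban1983to89.B1Eq324BenfattoSect5FreeStepCrossMasses
  (decayWeightedMass_le decayWeightedMass_le_of_far sum_classSum_eq_classSum_biUnion)

variable {d : ℕ}

section Generic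

variable {s D : ℕ} {ϰ : ℝ} {a : Coef d} {Jr : Finset (B1Eq324BenfattoLemma.Site d)}

/-- One class: `…FreeStepCrossMasses.decayWeightedMass_le` with `|R_A| ≤ L^d`. [cite: BenfattoEtAl1978, §5 p.159] -/
private theorem oneClass_le {δ c₂ A Ld : ℝ} (hres : 0 < ϰ / 2 - δ / 2 * ((D : ℝ) ^ 2 * Real.sqrt d)) (hc₂ : 0 < c₂) (hA0 : 0 ≤ A)
    (hA : ∀ (p : ℕ) (Δ : Fin p → B1Eq324BenfattoLemma.Site d) (n : Fin p → ℕ), |a p Δ n| ≤ A)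
    (cls : (p : ℕ) → Finset (Fin p → Jr)) (RA : Finset (B1Eq324BenfattoLemma.Site d)) (hRA : (RA.card : ℝ) ≤ Ld)
    (ρ : B1Eq324BenfattoLemma.Site d → ℝ) (hρ : ∀ y ∈ Jr, ∃ x ∈ RA, (∑ j, |((x j : ℝ) - (y j : ℝ))|) ≤ ρ y) :
    ∑ p ∈ Finset.Icc 1 s, ∑ Δ ∈ cls p, ∑ n ∈ admissible p D,
        |a p (fun i => (Δ i : B1Eq324BenfattoLemma.Site d)) n| *
          Real.exp (-(ϰ / 2) * connLength fun i => (Δ i : B1Eq324BenfattoLemma.Site d)) *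
          (Real.exp (δ / 2 * ((D : ℝ) ^ 2 * (Real.sqrt d * connLength (fun i => (Δ i : B1Eq324BenfattoLemma.Site d)) + d))) *
            Real.exp (-(c₂ * ρ (if h : 0 < p then (Δ ⟨0, h⟩ : B1Eq324BenfattoLemma.Site d) else 0)))) ≤
      A * Real.exp (δ / 2 * ((D : ℝ) ^ 2 * d)) * (Ld * (2 / (1 - Real.exp (-(c₂ / Real.sqrt d))) * Real.exp (c₂ / Real.sqrt d)) ^ d) *
        ∑ p ∈ Finset.Icc 1 s, ((admissible p D).card : ℝ) *
          ((2 / (1 - Real.exp (-((ϰ / 2 - δ / 2 * ((D : ℝ) ^ 2 * Real.sqrt d)) / (p : ℕ) / Real.sqrt d))) *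
            Real.exp ((ϰ / 2 - δ / 2 * ((D : ℝ) ^ 2 * Real.sqrt d)) / (p : ℕ) / Real.sqrt d)) ^ d) ^ (p - 1) := by
  refine (decayWeightedMass_le (s := s) (D := D) (ϰ := ϰ) (a := a) (δ := δ) hres hc₂ hA0 hA cls RA ρ hρ).trans ?_
  have hKnn : ∀ t : ℝ, 0 ≤ t → 0 ≤ 2 / (1 - Real.exp (-t)) := fun t ht =>
    div_nonneg zero_le_two (by rw [sub_nonneg, Real.exp_le_one_iff, neg_nonpos]; exact ht)
  have hK0 : 0 ≤ (2 / (1 - Real.exp (-(c₂ / Real.sqrt d))) * Real.exp (c₂ / Real.sqrt d)) ^ d := pow_nonneg (mul_nonneg (hKnn _ (div_nonneg hc₂.le (Real.sqrt_nonneg _))) (Real.exp_pos _).le) _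
  have hS0 : 0 ≤ ∑ p ∈ Finset.Icc 1 s, ((admissible p D).card : ℝ) *
          ((2 / (1 - Real.exp (-((ϰ / 2 - δ / 2 * ((D : ℝ) ^ 2 * Real.sqrt d)) / (p : ℕ) / Real.sqrt d))) *
            Real.exp ((ϰ / 2 - δ / 2 * ((D : ℝ) ^ 2 * Real.sqrt d)) / (p : ℕ) / Real.sqrt d)) ^ d) ^ (p - 1) :=
    Finset.sum_nonneg fun p _ => mul_nonneg (Nat.cast_nonneg _) (pow_nonneg (pow_nonneg (mul_nonneg
      (hKnn _ (div_nonneg (div_nonneg hres.le (Nat.cast_nonneg _)) (Real.sqrt_nonneg _))) (Real.exp_pos _).le) _) _)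
  exact mul_le_mul_of_nonneg_right (mul_le_mul_of_nonneg_left (mul_le_mul_of_nonneg_right hRA hK0) (by positivity)) hS0

/-- A far family of pairwise disjoint classes (anchors at `ρ ≥ r₀`): one class by `sum_classSum_eq_classSum_biUnion`, then
`…FreeStepCrossMasses.decayWeightedMass_le_of_far`. [cite: BenfattoEtAl1978, §5 p.159] -/
private theorem family_far_le {P : Type*} [DecidableEq P] {δ c₂ A Ld r₀ : ℝ} (hres : 0 < ϰ / 2 - δ / 2 * ((D : ℝ) ^ 2 * Real.sqrt d))
    (hc₂ : 0 < c₂) (hA0 : 0 ≤ A) (hA : ∀ (p : ℕ) (Δ : Fin p → B1Eq324BenfattoLemma.Site d) (n : Fin p → ℕ), |a p Δ n| ≤ A)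
    (Sc : Finset P) (clsF : P → (p : ℕ) → Finset (Fin p → Jr))
    (hdisj : ∀ p, ∀ c₁ ∈ Sc, ∀ c₂' ∈ Sc, c₁ ≠ c₂' → Disjoint (clsF c₁ p) (clsF c₂' p))
    (RA : Finset (B1Eq324BenfattoLemma.Site d)) (hRA : (RA.card : ℝ) ≤ Ld)
    (ρ : B1Eq324BenfattoLemma.Site d → ℝ) (hρ : ∀ y ∈ Jr, ∃ x ∈ RA, (∑ j, |((x j : ℝ) - (y j : ℝ))|) ≤ ρ y)
    (hfar : ∀ c ∈ Sc, ∀ p (hp : p ∈ Finset.Icc 1 s), ∀ Δ ∈ clsF c p,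
      r₀ ≤ ρ (Δ ⟨0, (Finset.mem_Icc.1 hp).1⟩ : B1Eq324BenfattoLemma.Site d)) :
    ∑ c ∈ Sc, ∑ p ∈ Finset.Icc 1 s, ∑ Δ ∈ clsF c p, ∑ n ∈ admissible p D,
        |a p (fun i => (Δ i : B1Eq324BenfattoLemma.Site d)) n| *
          Real.exp (-(ϰ / 2) * connLength fun i => (Δ i : B1Eq324BenfattoLemma.Site d)) *
          (Real.exp (δ / 2 * ((D : ℝ) ^ 2 * (Real.sqrt d * connLength (fun i => (Δ i : B1Eq324BenfattoLemma.Site d)) + d))) *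
            Real.exp (-(c₂ * ρ (if h : 0 < p then (Δ ⟨0, h⟩ : B1Eq324BenfattoLemma.Site d) else 0)))) ≤
      A * Real.exp (δ / 2 * ((D : ℝ) ^ 2 * d)) * Real.exp (-(c₂ / 2 * r₀)) * (Ld * (2 / (1 - Real.exp (-(c₂ / 2 / Real.sqrt d))) * Real.exp (c₂ / 2 / Real.sqrt d)) ^ d) *
        ∑ p ∈ Finset.Icc 1 s, ((admissible p D).card : ℝ) *
          ((2 / (1 - Real.exp (-((ϰ / 2 - δ / 2 * ((D : ℝ) ^ 2 * Real.sqrt d)) / (p : ℕ) / Real.sqrt d))) *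
            Real.exp ((ϰ / 2 - δ / 2 * ((D : ℝ) ^ 2 * Real.sqrt d)) / (p : ℕ) / Real.sqrt d)) ^ d) ^ (p - 1) := by
  classical
  rw [sum_classSum_eq_classSum_biUnion (s := s) (D := D) Sc clsF hdisj]
  refine (decayWeightedMass_le_of_far (s := s) (D := D) (ϰ := ϰ) (a := a) (δ := δ) hres hc₂ hA0 hA
    (fun p => Sc.biUnion fun c => clsF c p) RA ρ hρ (r₀ := r₀) (fun p hp Δ hΔ => ?_)).trans ?_
  · obtain ⟨c, hc, hΔc⟩ := Finset.mem_biUnion.1 hΔ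
    exact hfar c hc p hp Δ hΔc
  have hKnn : ∀ t : ℝ, 0 ≤ t → 0 ≤ 2 / (1 - Real.exp (-t)) := fun t ht =>
    div_nonneg zero_le_two (by rw [sub_nonneg, Real.exp_le_one_iff, neg_nonpos]; exact ht)
  have hK0 : 0 ≤ (2 / (1 - Real.exp (-(c₂ / 2 / Real.sqrt d))) * Real.exp (c₂ / 2 / Real.sqrt d)) ^ d :=
    pow_nonneg (mul_nonneg (hKnn _ (div_nonneg (half_pos hc₂).le (Real.sqrt_nonneg _))) (Real.exp_pos _).le) _
  have hS0 : 0 ≤ ∑ p ∈ Finset.Icc 1 s, ((admissible p D).card : ℝ) *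
          ((2 / (1 - Real.exp (-((ϰ / 2 - δ / 2 * ((D : ℝ) ^ 2 * Real.sqrt d)) / (p : ℕ) / Real.sqrt d))) *
            Real.exp ((ϰ / 2 - δ / 2 * ((D : ℝ) ^ 2 * Real.sqrt d)) / (p : ℕ) / Real.sqrt d)) ^ d) ^ (p - 1) :=
    Finset.sum_nonneg fun p _ => mul_nonneg (Nat.cast_nonneg _) (pow_nonneg (pow_nonneg (mul_nonneg
      (hKnn _ (div_nonneg (div_nonneg hres.le (Nat.cast_nonneg _)) (Real.sqrt_nonneg _))) (Real.exp_pos _).le) _) _)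
  exact mul_le_mul_of_nonneg_right (mul_le_mul_of_nonneg_left (mul_le_mul_of_nonneg_right hRA hK0) (by positivity)) hS0

/-- All classes of a pairwise disjoint family. [cite: BenfattoEtAl1978, §5 p.159] -/
private theorem family_all_le {P : Type*} [Fintype P] [DecidableEq P] {δ c₂ A Ld : ℝ}
    (hres : 0 < ϰ / 2 - δ / 2 * ((D : ℝ) ^ 2 * Real.sqrt d))
    (hc₂ : 0 < c₂) (hA0 : 0 ≤ A) (hA : ∀ (p : ℕ) (Δ : Fin p → B1Eq324BenfattoLemma.Site d) (n : Fin p → ℕ), |a p Δ n| ≤ A)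
    (clsF : P → (p : ℕ) → Finset (Fin p → Jr)) (hdisj : ∀ p c₁ c₂', c₁ ≠ c₂' → Disjoint (clsF c₁ p) (clsF c₂' p))
    (RA : Finset (B1Eq324BenfattoLemma.Site d)) (hRA : (RA.card : ℝ) ≤ Ld)
    (ρ : B1Eq324BenfattoLemma.Site d → ℝ) (hρ : ∀ y ∈ Jr, ∃ x ∈ RA, (∑ j, |((x j : ℝ) - (y j : ℝ))|) ≤ ρ y) :
    ∑ c, ∑ p ∈ Finset.Icc 1 s, ∑ Δ ∈ clsF c p, ∑ n ∈ admissible p D,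
        |a p (fun i => (Δ i : B1Eq324BenfattoLemma.Site d)) n| *
          Real.exp (-(ϰ / 2) * connLength fun i => (Δ i : B1Eq324BenfattoLemma.Site d)) *
          (Real.exp (δ / 2 * ((D : ℝ) ^ 2 * (Real.sqrt d * connLength (fun i => (Δ i : B1Eq324BenfattoLemma.Site d)) + d))) *
            Real.exp (-(c₂ * ρ (if h : 0 < p then (Δ ⟨0, h⟩ : B1Eq324BenfattoLemma.Site d) else 0)))) ≤
      A * Real.exp (δ / 2 * ((D : ℝ) ^ 2 * d)) * (Ld * (2 / (1 - Real.exp (-(c₂ / Real.sqrt d))) * Real.exp (c₂ / Real.sqrt d)) ^ d) *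
        ∑ p ∈ Finset.Icc 1 s, ((admissible p D).card : ℝ) *
          ((2 / (1 - Real.exp (-((ϰ / 2 - δ / 2 * ((D : ℝ) ^ 2 * Real.sqrt d)) / (p : ℕ) / Real.sqrt d))) *
            Real.exp ((ϰ / 2 - δ / 2 * ((D : ℝ) ^ 2 * Real.sqrt d)) / (p : ℕ) / Real.sqrt d)) ^ d) ^ (p - 1) := by
  classical
  rw [sum_classSum_eq_classSum_biUnion (s := s) (D := D) (Finset.univ : Finset P) clsF
    (fun p c₁ _ c₂' _ hne => hdisj p c₁ c₂' hne)]
  exact oneClass_le hres hc₂ hA0 hA _ RA hRA ρ hρ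

/-- The real-algebra assembly of the three mass bounds. [folklore] -/
private theorem crossAssemble {kk Wt Wf Wa Mu Muf : ℝ} {e : ℕ} (hkk : 0 ≤ kk) (hWf : 0 ≤ Wf) (hWa : 0 ≤ Wa)
    (hMu : 0 ≤ Mu) (h1 : Wt ≤ Mu) (h2 : Wf ≤ Muf) (h3 : Wa ≤ Mu) :
    kk * (Wt * Wf * Wa ^ e) ≤ kk * (Mu * (Muf * Mu ^ e)) := by
  refine mul_le_mul_of_nonneg_left ?_ hkk
  calc Wt * Wf * Wa ^ e ≤ Mu * Muf * Mu ^ e :=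
        mul_le_mul (mul_le_mul h1 h2 hWf hMu) (pow_le_pow_left₀ hWa h3 e) (pow_nonneg hWa e) (mul_nonneg hMu (hWf.trans h2))
    _ = Mu * (Muf * Mu ^ e) := by ring

end Generic

variable {α β : ℝ} {s D : ℕ} {κ : ℝ} {a : Coef d} {J : Finset (B1Eq324BenfattoLemma.Site d)} {L w v : ℕ}
  {B : Finset (B1Eq324BenfattoLemma.Site d)}

/-- **THE CROSS COLOURINGS IN CLOSED FORM** (see the module docstring for the four palette properties).
[cite: BenfattoEtAl1978, §5 p.159, Appendix D p.166] -/
theorem abs_cross_le_closed (hα : 0 < α) (hβ : 0 < β) (hd : 0 < d) (hL : 0 < L) {δ A : ℝ}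
    (hres : 0 < κ / 2 - δ / 2 * ((D : ℝ) ^ 2 * Real.sqrt d)) (hδ : 0 < δ) (hδle : δ ≤ Real.log ((2 * d + α ^ 2) / (2 * d)))
    (hA0 : 0 ≤ A) (hA : ∀ (p : ℕ) (Δ : Fin p → B1Eq324BenfattoLemma.Site d) (n : Fin p → ℕ), |a p Δ n| ≤ A)
    (hne : ∀ m : ↥B, (shrink L (m : B1Eq324BenfattoLemma.Site d) (2 * w + v)).Nonempty)
    (cls : Option (↥B × Bool) → (p : ℕ) → Finset (Fin p → J))
    (hdeep : ∀ m : ↥B, ∀ p ∈ Finset.Icc 1 s, ∀ Δ ∈ cls (some (m, true)) p,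
      ∃ i, (Δ i : B1Eq324BenfattoLemma.Site d) ∈ shrink L (m : B1Eq324BenfattoLemma.Site d) (2 * w + v))
    (hnone : ∀ p, ∀ Δ ∈ cls none p, ∀ i, (Δ i : B1Eq324BenfattoLemma.Site d) ∈ corridors L w B)
    (hbox : ∀ (m : ↥B) (bb : Bool) p, ∀ Δ ∈ cls (some (m, bb)) p, ∀ i,
      (Δ i : B1Eq324BenfattoLemma.Site d) ∈ box L (m : B1Eq324BenfattoLemma.Site d))
    (hdisj : ∀ p c₁ c₂, c₁ ≠ c₂ → Disjoint (cls c₁ p) (cls c₂ p)) (k : ℕ) :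
    |∑ f ∈ univ.filter (fun f : Fin (k + 1) → Option (↥B × Bool) =>
          (∃ j m, f j = some (m, true)) ∧ ¬∃ m, ∀ j, f j = some (m, false) ∨ f j = some (m, true)),
        ursellOf (fun P : Finset (Fin (k + 1)) => ∫ z, ∏ j ∈ P,
          (∑ p ∈ Finset.Icc 1 s, ∑ Δ ∈ cls (f j) p, ∑ n ∈ admissible p D, term κ a z p Δ n) ∂P0 d α β) univ| ≤
      2 ^ ((k + 1) * D) * 2 ^ 2 ^ ((k + 1) * D) * (max 1 (freeCov d α β 0 0)) ^ ((k + 1) * D) *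
        (B.card * (((k + 1 : ℕ) : ℝ) * (k : ℝ) *
          ((A * Real.exp (δ / 2 * ((D : ℝ) ^ 2 * d)) * ((L : ℝ) ^ d * (2 / (1 - Real.exp (-(δ / (2 * ((k + 1 : ℕ) : ℝ)) / Real.sqrt d))) * Real.exp (δ / (2 * ((k + 1 : ℕ) : ℝ)) / Real.sqrt d)) ^ d) *
              ∑ p ∈ Finset.Icc 1 s, ((admissible p D).card : ℝ) *
                ((2 / (1 - Real.exp (-((κ / 2 - δ / 2 * ((D : ℝ) ^ 2 * Real.sqrt d)) / (p : ℕ) / Real.sqrt d))) *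
                  Real.exp ((κ / 2 - δ / 2 * ((D : ℝ) ^ 2 * Real.sqrt d)) / (p : ℕ) / Real.sqrt d)) ^ d) ^ (p - 1)) *
            ((A * Real.exp (δ / 2 * ((D : ℝ) ^ 2 * d)) * Real.exp (-(δ / (2 * ((k + 1 : ℕ) : ℝ)) / 2 * ((w : ℝ) + v + 1))) * ((L : ℝ) ^ d * (2 / (1 - Real.exp (-(δ / (2 * ((k + 1 : ℕ) : ℝ)) / 2 / Real.sqrt d))) * Real.exp (δ / (2 * ((k + 1 : ℕ) : ℝ)) / 2 / Real.sqrt d)) ^ d) *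
              ∑ p ∈ Finset.Icc 1 s, ((admissible p D).card : ℝ) *
                ((2 / (1 - Real.exp (-((κ / 2 - δ / 2 * ((D : ℝ) ^ 2 * Real.sqrt d)) / (p : ℕ) / Real.sqrt d))) *
                  Real.exp ((κ / 2 - δ / 2 * ((D : ℝ) ^ 2 * Real.sqrt d)) / (p : ℕ) / Real.sqrt d)) ^ d) ^ (p - 1)) *
             (A * Real.exp (δ / 2 * ((D : ℝ) ^ 2 * d)) * ((L : ℝ) ^ d * (2 / (1 - Real.exp (-(δ / (2 * ((k + 1 : ℕ) : ℝ)) / Real.sqrt d))) * Real.exp (δ / (2 * ((k + 1 : ℕ) : ℝ)) / Real.sqrt d)) ^ d) *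
              ∑ p ∈ Finset.Icc 1 s, ((admissible p D).card : ℝ) *
                ((2 / (1 - Real.exp (-((κ / 2 - δ / 2 * ((D : ℝ) ^ 2 * Real.sqrt d)) / (p : ℕ) / Real.sqrt d))) *
                  Real.exp ((κ / 2 - δ / 2 * ((D : ℝ) ^ 2 * Real.sqrt d)) / (p : ℕ) / Real.sqrt d)) ^ d) ^ (p - 1)) ^ (k - 1))))) := by
  classical
  -- the anchor length: ℓ¹-distance to the deep region, realised by a minimiser (no lattice structure on ℝ needed)
  have hmin : ∀ (m : ↥B) (y : B1Eq324BenfattoLemma.Site d), ∃ x ∈ shrink L (m : B1Eq324BenfattoLemma.Site d) (2 * w + v),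
      ∀ x' ∈ shrink L (m : B1Eq324BenfattoLemma.Site d) (2 * w + v),
        (∑ j, |((x j : ℝ) - (y j : ℝ))|) ≤ ∑ j, |((x' j : ℝ) - (y j : ℝ))| := fun m y =>
    Finset.exists_min_image _ (fun x => ∑ j, |((x j : ℝ) - (y j : ℝ))|) (hne m)
  choose xs hxs hxmin using hmin
  obtain ⟨ρ, hρdef⟩ : ∃ ρ : ↥B → B1Eq324BenfattoLemma.Site d → ℝ, ∀ m y, ρ m y = ∑ j, |((xs m y j : ℝ) - (y j : ℝ))| :=
    ⟨fun m y => ∑ j, |((xs m y j : ℝ) - (y j : ℝ))|, fun _ _ => rfl⟩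
  have hρle : ∀ m : ↥B, ∀ x ∈ shrink L (m : B1Eq324BenfattoLemma.Site d) (2 * w + v), ∀ y,
      ρ m y ≤ ∑ j, |((x j : ℝ) - (y j : ℝ))| := fun m x hx y => by
    rw [hρdef]
    exact hxmin m y x hx
  have hρex : ∀ m : ↥B, ∀ y ∈ J, ∃ x ∈ shrink L (m : B1Eq324BenfattoLemma.Site d) (2 * w + v),
      (∑ j, |((x j : ℝ) - (y j : ℝ))|) ≤ ρ m y := fun m y _ =>
    ⟨xs m y, hxs m y, by rw [hρdef]⟩
  have hρge : ∀ m : ↥B, ∀ y, ∀ r : ℝ, (∀ x ∈ shrink L (m : B1Eq324BenfattoLemma.Site d) (2 * w + v),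
      r ≤ ∑ j, |((x j : ℝ) - (y j : ℝ))|) → r ≤ ρ m y := fun m y r h => by
    rw [hρdef]
    exact h _ (hxs m y)
  have hc₂ : 0 < δ / (2 * ((k + 1 : ℕ) : ℝ)) := by positivity
  have hcard : ∀ m : ↥B, ((shrink L (m : B1Eq324BenfattoLemma.Site d) (2 * w + v)).card : ℝ) ≤ (L : ℝ) ^ d := fun m => by
    exact_mod_cast card_shrink_le L (m : B1Eq324BenfattoLemma.Site d) (2 * w + v)
  -- the far classes of anchor `m` are anchored at `ρ_m ≥ w+v+1`
  have hfar : ∀ m : ↥B, ∀ c ∈ ((univ : Finset (Option (↥B × Bool))).erase (some (m, false))).erase (some (m, true)),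
      ∀ p (hp : p ∈ Finset.Icc 1 s), ∀ Δ ∈ cls c p,
        (w : ℝ) + v + 1 ≤ ρ m (Δ ⟨0, (Finset.mem_Icc.1 hp).1⟩ : B1Eq324BenfattoLemma.Site d) := by
    intro m c hc p hp Δ hΔ
    have hc1 : c ≠ some (m, true) := Finset.ne_of_mem_erase hc
    have hc2 : c ≠ some (m, false) := Finset.ne_of_mem_erase (Finset.mem_of_mem_erase hc)
    refine hρge m _ _ fun x hx => ?_
    have hx' : x ∈ shrink L (m : B1Eq324BenfattoLemma.Site d) (w + (w + v)) := by
      rw [show w + (w + v) = 2 * w + v by ring]; exact hx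
    rcases c with _ | ⟨m', bb⟩
    · have hy := hnone p Δ hΔ ⟨0, (Finset.mem_Icc.1 hp).1⟩
      have hy' : (Δ ⟨0, (Finset.mem_Icc.1 hp).1⟩ : B1Eq324BenfattoLemma.Site d) ∉ shrink L (m : B1Eq324BenfattoLemma.Site d) w :=
        fun h => Finset.disjoint_left.1 (disjoint_corridors_shrink hL w B (m : B1Eq324BenfattoLemma.Site d)) hy h
      have h := le_l1_of_mem_shrink_of_not_mem_shrink hx' hy'
      push_cast at h ⊢
      linarith
    · have hm' : m' ≠ m := by
        rintro rfl
        cases bb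
        · exact hc2 rfl
        · exact hc1 rfl
      have hne' : (m' : B1Eq324BenfattoLemma.Site d) ≠ (m : B1Eq324BenfattoLemma.Site d) := fun h => hm' (Subtype.ext h)
      have hy := hbox m' bb p Δ hΔ ⟨0, (Finset.mem_Icc.1 hp).1⟩
      have hy' : (Δ ⟨0, (Finset.mem_Icc.1 hp).1⟩ : B1Eq324BenfattoLemma.Site d) ∉ box L (m : B1Eq324BenfattoLemma.Site d) :=
        fun h => Finset.disjoint_left.1 (disjoint_box hL hne') hy h
      have h := le_l1_of_mem_shrink_of_not_mem_box hx hy'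
      push_cast at h ⊢
      linarith
  have hnn : ∀ (m : ↥B) (c : Option (↥B × Bool)), 0 ≤ ∑ p ∈ Finset.Icc 1 s, ∑ Δ ∈ cls c p, ∑ n ∈ admissible p D,
      |a p (fun i => (Δ i : B1Eq324BenfattoLemma.Site d)) n| *
        Real.exp (-(κ / 2) * connLength fun i => (Δ i : B1Eq324BenfattoLemma.Site d)) *
        (Real.exp (δ / 2 * ((D : ℝ) ^ 2 * (Real.sqrt d * connLength (fun i => (Δ i : B1Eq324BenfattoLemma.Site d)) + d))) *
          Real.exp (-(δ / (2 * ((k + 1 : ℕ) : ℝ)) *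
            ρ m (if h : 0 < p then (Δ ⟨0, h⟩ : B1Eq324BenfattoLemma.Site d) else 0)))) := fun m c =>
    Finset.sum_nonneg fun p _ => Finset.sum_nonneg fun Δ _ => Finset.sum_nonneg fun n _ =>
      mul_nonneg (mul_nonneg (abs_nonneg _) (Real.exp_pos _).le) (mul_nonneg (Real.exp_pos _).le (Real.exp_pos _).le)
  -- assemble
  have hmain := abs_cross_le_sum_anchor (s := s) (D := D) (κ := κ) (a := a) hα hβ hd cls hdeep hδ.le hδle ρ hρle k
  refine le_trans hmain (mul_le_mul_of_nonneg_left ?_ (by positivity))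
  refine (Finset.sum_le_sum fun m _ => crossAssemble (by positivity) (Finset.sum_nonneg fun c _ => hnn m c)
    (Finset.sum_nonneg fun c _ => hnn m c) ((hnn m none).trans (oneClass_le hres hc₂ hA0 hA (cls none) _ (hcard m) (ρ m) (hρex m)))
    (oneClass_le hres hc₂ hA0 hA (cls (some (m, true))) _ (hcard m) (ρ m) (hρex m))
    (family_far_le hres hc₂ hA0 hA _ cls (fun p c₁ _ c₂' _ hne' => hdisj p c₁ c₂' hne') _ (hcard m) (ρ m) (hρex m) (hfar m))
    (family_all_le hres hc₂ hA0 hA cls hdisj _ (hcard m) (ρ m) (hρex m))).trans (le_of_eq ?_)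
  rw [Finset.sum_const, nsmul_eq_mul, Finset.card_univ, Fintype.card_coe]

end Literature.MathematicalPhysics.QuantumFieldTheory.Balaban1983to89.B1Eq324BenfattoSect5FreeStepCrossBound
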